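import Literature.NumberTheory.Transcendental.OnePeriodsClosedPathsRational
import HarnessLib

/-!
# Averages of rational functions over the unit circle are algebraic (residue calculus)

Companion of `Literature/NumberTheory/Transcendental/OnePeriodsClosedPathsRational.lean` (the
residue theorem for rational `1`-forms along closed `C¹` loops,
`ClosedPathPeriods.exists_residues`, built for the genus-`0` slices of the named fact
`completePlaneCurvePeriods_zero_or_transcendental`).  Applied to the loop `u(t) = e^{2πit}` and
the form `P(u) du/(u Q(u))` it gives the classical evaluation of trigonometric integrals by
residues:

  `∫₀¹ P(e^{2πit})/Q(e^{2πit}) dt = Σ_ρ c_ρ · wind(e^{2πit} − ρ) ∈ K`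

for `P, Q ∈ K[X]`, `K ⊆ ℂ` an algebraically closed field, `Q` without zeros on the unit circle
(`ClosedPathPeriods.exists_circleAverage_eq`).  For `K = ℚ̄ = algebraicClosure ℚ ℂ` (or
`P, Q ∈ ℚ[X]`): **the average over a period of a rational function of `cos 2πt, sin 2πt` with
algebraic coefficients is an algebraic number** (`ClosedPathPeriods.isAlgebraic_circleAverage`,
`ClosedPathPeriods.isAlgebraic_circleAverage_rat`) — e.g. `∫₀¹ dt/(3 − cos 2πt) = 1/(2√2)`.  In
the language of periods: such integrals are periods of `H¹(𝔾_m, {poles})`-type over closed paths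
divided by `2πi`, i.e. `ℚ̄`-combinations of residues (Huber–Wüstholz, Ch. 12–13: the periods of a
rational form over a closed path on `ℙ¹ ∖ {points}` lie in `ℚ̄ · 2πi`).  This is the form in
which areas of rationally parametrised ovals (`∮ x dy` with `x, y ∈ ℚ̄(e^{2πit})`) are seen to lie
in `ℚ̄ · π`.

## References

* L. V. Ahlfors, *Complex Analysis*, 3rd ed., McGraw–Hill 1979, Ch. 4 §5.3 (evaluation of
  definite integrals `∫₀^{2π} R(cos θ, sin θ) dθ` by residues) — folklore.
* A. Huber, G. Wüstholz, *Transcendence and Linear Relations of 1-Periods*, Cambridge Tracts in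
  Mathematics 227, CUP 2022 [HuberWustholz2022], Ch. 12–13.
-/

noncomputable section

open MvPolynomial Complex
open scoped Real Polynomial

namespace Literature.NumberTheory.Transcendental

namespace ClosedPathPeriods

open Literature.Topology.PlaneTopology Literature.Analysis.Complex IntermediateField

/-- The standard loop `u(t) = e^{2πit}`: `C¹`, `u(0) = u(1)`, nowhere zero, `u′ = 2πi u`.
[folklore] -/
theorem circleLoop_props :
    ContDiff ℝ 1 (fun t : ℝ => exp (2 * π * I * t)) ∧
      (fun t : ℝ => exp (2 * π * I * t)) 0 = (fun t : ℝ => exp (2 * π * I * t)) 1 ∧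
      (∀ t : ℝ, exp (2 * π * I * t) ≠ 0) ∧
      ∀ t : ℝ, deriv (fun s : ℝ => exp (2 * π * I * s)) t = 2 * π * I * exp (2 * π * I * t) := by
  refine ⟨contDiff_exp_const_mul_ofReal _, ?_, fun t => exp_ne_zero _, fun t =>
    (hasDerivAt_exp_const_mul_ofReal _ t).deriv⟩
  simp only [Complex.ofReal_zero, mul_zero, Complex.exp_zero, Complex.ofReal_one, mul_one]
  exact Complex.exp_two_pi_mul_I.symm

/-- **Trigonometric integrals by residues.**  For an algebraically closed field `K ⊆ ℂ` and
`P, Q ∈ K[X]` with `Q(e^{2πit}) ≠ 0` for all `t`, the average `∫₀¹ P(e^{2πit})/Q(e^{2πit}) dt`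
lies in `K`: it equals `Σ_ρ c_ρ · wind(e^{2πit} − ρ)` over the roots `ρ` of `X Q`, with the
residues `c_ρ ∈ K` of `P dX/(X Q)` (`exists_residues` along `u = e^{2πit}`, `du = 2πi u dt`).
[folklore] -/
theorem exists_circleAverage_eq {K : Type*} [Field K] [Algebra K ℂ] [DecidableEq K] [IsAlgClosed K]
    (P Q : K[X]) (hQ : ∀ t : ℝ, Polynomial.aeval (exp (2 * π * I * t)) Q ≠ 0) :
    ∃ a : K, (∫ t in (0:ℝ)..1, Polynomial.aeval (exp (2 * π * I * t)) P /
        Polynomial.aeval (exp (2 * π * I * t)) Q) = algebraMap K ℂ a := by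
  obtain ⟨hu, h01, hu0, hud⟩ := circleLoop_props
  have hQ0 : Q ≠ 0 := by
    intro h
    apply hQ 0
    rw [h, map_zero]
  have hQX : Q * Polynomial.X ≠ 0 := mul_ne_zero hQ0 Polynomial.X_ne_zero
  obtain ⟨c, hc⟩ := exists_residues P (Q * Polynomial.X) hQX
  have hQXu : ∀ t : ℝ, Polynomial.aeval (exp (2 * π * I * t)) (Q * Polynomial.X) ≠ 0 := fun t => by
    rw [map_mul, Polynomial.aeval_X]
    exact mul_ne_zero (hQ t) (hu0 t)
  have key := (hc (fun t : ℝ => exp (2 * π * I * t)) hu h01 hQXu).2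
  -- the integrand of `key` is `2πi · P(u)/Q(u)`
  have hint : ∀ t : ℝ, Polynomial.aeval (exp (2 * π * I * t)) P /
      Polynomial.aeval (exp (2 * π * I * t)) (Q * Polynomial.X) *
        deriv (fun s : ℝ => exp (2 * π * I * s)) t =
      2 * π * I * (Polynomial.aeval (exp (2 * π * I * t)) P /
        Polynomial.aeval (exp (2 * π * I * t)) Q) := by
    intro t
    rw [hud t, map_mul, Polynomial.aeval_X]
    field_simp [hQ t, hu0 t]
  simp_rw [hint] at key
  rw [intervalIntegral.integral_const_mul] at key
  refine ⟨∑ ρ ∈ (Q * Polynomial.X).roots.toFinset,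
    c ρ * (wind (fun t : ℝ => exp (2 * π * I * t) - algebraMap K ℂ ρ) : K), ?_⟩
  have h2pi : (2 * π * I : ℂ) ≠ 0 := by simp [Real.pi_ne_zero, Complex.I_ne_zero]
  apply mul_left_cancel₀ h2pi
  rw [key, mul_comm, map_sum]
  refine congrArg (2 * π * I * ·) (Finset.sum_congr rfl fun ρ _ => ?_)
  rw [map_mul, map_intCast]

/-- **The average over a period of a `ℚ̄`-rational function of `e^{2πit}` is algebraic**:
for `P, Q ∈ ℚ̄[X]` (`ℚ̄ = algebraicClosure ℚ ℂ`) with `Q(e^{2πit}) ≠ 0` for all `t`,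
`∫₀¹ P(e^{2πit})/Q(e^{2πit}) dt ∈ ℚ̄` (a `ℚ̄`-combination of residues). [folklore] -/
theorem isAlgebraic_circleAverage (P Q : (algebraicClosure ℚ ℂ)[X])
    (hQ : ∀ t : ℝ, Polynomial.aeval (exp (2 * π * I * t)) Q ≠ 0) :
    IsAlgebraic ℚ (∫ t in (0:ℝ)..1, Polynomial.aeval (exp (2 * π * I * t)) P /
        Polynomial.aeval (exp (2 * π * I * t)) Q) := by
  classical
  haveI : IsAlgClosed (algebraicClosure ℚ ℂ) := (algebraicClosure.isAlgClosure ℚ ℂ).isAlgClosed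
  obtain ⟨a, ha⟩ := exists_circleAverage_eq P Q hQ
  rw [ha, IntermediateField.algebraMap_apply]
  exact mem_algebraicClosure_iff.1 a.2

/-- **Rational version**: for `P, Q ∈ ℚ[X]` with `Q(e^{2πit}) ≠ 0` for all `t`, the average
`∫₀¹ P(e^{2πit})/Q(e^{2πit}) dt` — i.e. `∫₀¹ R(cos 2πt, sin 2πt) dt` for the rational function
`R` it defines — is an algebraic number (e.g. `∫₀¹ dt/(3 − cos 2πt) = 1/(2√2)`). [folklore] -/
theorem isAlgebraic_circleAverage_rat (P Q : ℚ[X])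
    (hQ : ∀ t : ℝ, Polynomial.aeval (exp (2 * π * I * t)) Q ≠ 0) :
    IsAlgebraic ℚ (∫ t in (0:ℝ)..1, Polynomial.aeval (exp (2 * π * I * t)) P /
        Polynomial.aeval (exp (2 * π * I * t)) Q) := by
  have h := isAlgebraic_circleAverage (P.map (algebraMap ℚ (algebraicClosure ℚ ℂ)))
    (Q.map (algebraMap ℚ (algebraicClosure ℚ ℂ))) (fun t => by
      rw [Polynomial.aeval_map_algebraMap]; exact hQ t)
  simpa only [Polynomial.aeval_map_algebraMap] using h

end ClosedPathPeriods

end Literature.NumberTheory.Transcendental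

end
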